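import Summits.QuantumFields.YangMills.Theorems.BalabanUVNodesN11OldBranchIntegrableOfDominated

/-!
# DAG node N11 — THE SPECIFICATION OF THE NO-EXPANSION 𝐓-STEP FOR A GENERIC STAGE-13 PARAMETER: every row the VALUE of the history-indexed residual `θ.Zh` must
# satisfy at a no-expansion history, in ONE witness-first theorem (pin rows (P)∕(V)∕`quad_k(∅)`∕locality of `quad`; unity; measurability; A-fibre domination; and the
# two term-data rows) — the honest target for node00-def-K0b now that the certificate `rePinH θ` is known to be degenerate off the diagonal (its `quad ≡ 0`)

HEADER — WORK-UNIT METADATA.  Cell `pub-ymgap`, YM-PLAN Track A (HUMAN RULING D-0062), seat `pub-ymgap-dag-n11-d` (g10; R134 fan-out seat N11 [B14], strategy s2),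
route `BalabanUVNodes` rev 25, item K1⁷ `StabilityBAtRecordR13SepCoPH` = stmt-QuantumFields-20542 (helper, `--kind proof --supports 20542 --as helper`, count-neutral).
[III] = [Balaban1988Convergent].  Over this seat's g10 files B3 `…N11NoExpansionOldBranchGraph` (`clause_succ_CoPH_of_Omega_empty_of_pinChi_of_oldBranch_of_clause_of_graph`,
generic `θ : Stage13HParams`), A1∕A2 (`IsFluctLocal`, `sLaw₁₃CoPH_iff_exists_local`, `action23_sect2ActionDataOfRecord_congr_fluct_of_isFluctLocal`) and FILE 9
`…N11OldBranchIntegrableOfDominated` (`integrable_oldBranch_of_dominated`, generic `θ`).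

WHY THIS FILE.  The g10 faces at `rePinH θ` (FILE 6, FILE 9) discharge the PIN rows of the general step by the certificate value `ZhPinOfRecord₁₃` — but that value keeps
K0a's `quad ≡ 0`, which this seat LOCATED as degenerate for every history with fluctuation integrals (the A-factor integrates a `{0,1}`-valued weight over a set of
infinite Lebesgue measure; print's (3.23) carries `exp(−½⟨A, Δ^{(j)}A⟩)`).  So the value of record must be ANOTHER `Zh` — one whose `quad` is [I]'s Gaussian form — and
the honest deliverable of this lane is the COMPLETE LIST OF ROWS such a value must meet for the no-expansion 𝐓-step to follow, at a generic `θ : Stage13HParams`, with no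
kernel-opaque binder and no binder over «all term families».  This file is that list, as one theorem.

WHAT THIS FILE PROVES (0 `sorry`, 0 `def`; 1 thm).  ★★★ `exists_local_witness_clause_succ_of_sLaw₁₃CoPH_of_rows` — from `θ.Provisos₁₃CoPH`, `θ.ZhUnity`, `1 ≤ M`, `k < K`
and `SLaw₁₃CoPH θ p k`: ∃ law-abiding `k`-local `(t, E_k)` carrying the level-`k` dichotomy such that for EVERY history `s′` with `Ω_{k+1}(s′) = ∅` the 𝐓-image clause
at `s′` holds for `(t (init s′), E_k(init s′))` PROVIDED the rows: (P) prefix agreement of `θ.zhAt p s′` with `θ.zhAt p (init s′)` below `k`; (V) the generation-`k` pin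
`ζ0_k(T)(U,V′) = χ_k(init s′)(U)·w_k(s′)(U,Ū)`; `quad_k(∅) = 0` on the two-scale configurations; `k`-locality of `quad_j(Λ_{j+1})`, `j < k`; measurability of `ζ0_j(Y)`,
`quad_j(Λ′)`; per old branch `S`: A-fibre domination of `χ_A·e^{−½quad}` by an integrable `ŵ_j`; the old operand of the witness measurable and bounded on `MultiCfg`.

HONEST FRAMING.  Helper lane of K1⁷; composition of accepted kernel bookkeeping; nothing of Bałaban's estimates is asserted; no law of record is edited or posited.
All rows are properties of the DATA (`θ.Zh`'s value — node00-def-K0b; the term values and background — node00-def-T ∕ def-R); sequences with `Ω_{k+1}(s′) ≠ ∅` are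
[III] §3 + Thm 2 proper (𝐑), not this lane's.  N11 NOT discharged; K1⁷ NOT closed; counts unmoved (typed 28∕28 · discharged 5∕27).  One finite four-torus programme at
fixed `ε = L^{−K}` — NOT ℝ⁴, NOT OS, NOT a mass gap, NOT Clay.  No `sorry`, `axiom`, `instance`, `notation`.
Sources (SHAPE only): [III] Theorem p.245, (2.17)–(2.18) p.257, (2.20)–(2.25) pp.258–259, (3.16)–(3.21) pp.268–269, (3.23)–(3.25) p.270, Thm 1 p.262; [IV] (0.2)–(0.3) p.176.
-/

noncomputable section

open MeasureTheory
open scoped BigOperators ENNReal NNReal Matrix.Norms.L2Operator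

namespace Summit.QuantumFields.YangMills.Theorems.BalabanUVNodesN11NoExpansionStepSpecification

open Literature.MathematicalPhysics.QuantumFieldTheory.Balaban1983to89 T4Continuum T4NestedCovariance Node00 Node00.Tk DagBinding
open B15DeterminingSets
open BalabanUVNodesN11FluctTruncationDefs
open BalabanUVNodesN11FluctTruncation (sLaw₁₃CoPH_iff_exists_local)
open BalabanUVNodesN11NoExpansionOldBranchGraph (clause_succ_CoPH_of_Omega_empty_of_pinChi_of_oldBranch_of_clause_of_graph)
open BalabanUVNodesN11OldBranchIntegrableOfDominated (integrable_oldBranch_of_dominated)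

variable {F : T4Family} {N : ℕ} [NeZero N]

variable (θ : Stage13HParams F N) (p : B12.RunParams)

/-- **★★★ THE SPECIFICATION OF THE NO-EXPANSION 𝐓-STEP AT A GENERIC STAGE-13 PARAMETER, `SLaw`-KEYED, WITNESS FIRST.**  See the module header for the list of rows;
their order below: run∕numerics (`h`, `hU`, `hk`, `hM`, `hS`); then, inside the conclusion, per no-expansion history `s′`: the four PIN rows of the general step
((P) `hpre`, (V) `hZ`, `hq`, `hqloc`), the two measurability rows of the residual serving `s′`, and per old branch the A-fibre domination and the operand rows.
[cite: Balaban1988Convergent, Theorem p.245, Thm 1 p.262, (3.24)–(3.25) p.270, (2.18) p.257, (2.20)–(2.23) p.258, (3.16)–(3.21) pp.268–269; Balaban1989LargeFieldI, (0.2)–(0.3) p.176] -/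
theorem exists_local_witness_clause_succ_of_sLaw₁₃CoPH_of_rows (h : θ.Provisos₁₃CoPH F N) (hU : θ.ZhUnity F N) {k : ℕ} (hk : k < p.K) (hM : 1 ≤ θ.τ9.M)
    (hS : SLaw₁₃CoPH F N θ p k) :
    ∃ (t : SeqOfRecord F θ.ν θ.τ9.M (gOfRecord₁₃ F N θ.toStage13Params p) p.K k → Sect2.TermValues (F.P p.K) (MatA N) (FluctV N) θ.τ9.M)
      (Ek : SeqOfRecord F θ.ν θ.τ9.M (gOfRecord₁₃ F N θ.toStage13Params p) p.K k → ℝ),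
      HasSect2FormAtZS F N (FluctV N) p.K (settingOfRecord₁₃ F N θ.toStage13Params p) k (θ.rzAt p) (WtOfRecord₁₃H F N θ p)
          (UbgOfRecord₁₃CoP F N θ.toStage13Params p k)
          (fun s₀ t₀ => Sect2.LawsRT (sect2TowerOfRecord F N (FluctV N) p.K (settingOfRecord₁₃ F N θ.toStage13Params p) (θ.rzAt p s₀) s₀ t₀)
            (settingOfRecord₁₃ F N θ.toStage13Params p).lf k)
          (slotsOfRecord F N θ.ν θ.τ9 (EOfRecord₁₃ F N θ.toStage13Params) (wOfRecord₉ F N θ.toStage9Params) θ.ppSel p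
            (gOfRecord₁₃ F N θ.toStage13Params p) k) t Ek ∧
      (∀ s₀, IsFluctLocal k (t s₀)) ∧
      ∀ (s : SeqOfRecord F θ.ν θ.τ9.M (gOfRecord₁₃ F N θ.toStage13Params p) p.K (k + 1)), s.Ω (k + 1) = ∅ →
        -- (P) prefix agreement below `k`
        (∀ j, j < k → (θ.zhAt p s).ζ0 j = (θ.zhAt p s.init).ζ0 j ∧ (θ.zhAt p s).quad j = (θ.zhAt p s.init).quad j) →
        -- (V) the generation-`k` pin with the old front factor
        (∀ (V' : GaugeField (F.P p.K) (k + 1) (SU N)) (U₀ : GaugeField (F.P p.K) k (SU N)),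
          (θ.zhAt p s).ζ0 k Set.univ (pairCfgAt (V := FluctV N) k V' U₀) =
            chiSeqOfRecord F N θ.ν θ.τ9.M (gOfRecord₁₃ F N θ.toStage13Params p) p.K k s.init U₀ *
              wOfRecord₉ F N θ.toStage9Params p (gOfRecord₁₃ F N θ.toStage13Params p) k s U₀ ((avOfRecord F N p.K k).avg U₀)) →
        -- `quad_k(∅) = 0` on the two-scale configurations
        (∀ (V' : GaugeField (F.P p.K) (k + 1) (SU N)) (U₀ : GaugeField (F.P p.K) k (SU N)), (θ.zhAt p s).quad k ∅ (pairCfgAt (V := FluctV N) k V' U₀) = 0) →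
        -- `k`-locality of `quad_j(Λ_{j+1})`, `j < k`
        (∀ j, j < k → ∀ ω ω' : MultiCfg (F.P p.K) (SU N) (FluctV N), (∀ i, i ≤ k → ω i = ω' i) →
          (θ.zhAt p s).quad j (s.init.Λ (j + 1)) ω = (θ.zhAt p s).quad j (s.init.Λ (j + 1)) ω') →
        -- measurability of the residual serving `s′`
        (∀ j (Y : Set (Site (F.P p.K) 0)), Measurable ((θ.zhAt p s).ζ0 j Y)) →
        (∀ j (Λ' : Set (Site (F.P p.K) 0)), Measurable ((θ.zhAt p s).quad j Λ')) →
        -- per old branch: A-fibre domination (K0b) and the operand rows (def-T ∕ def-R)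
        (∀ S ∈ admSOfRecord F θ.ν θ.τ9.M (gOfRecord₁₃ F N θ.toStage13Params p) p.K k s.init, ∀ j : ℕ,
          ∃ ŵ : (↥(Set.toFinite (B10Eq42TorusConstraint.bondsIn j ((s.init.Λ (j + 1))ᶜ ∩ s.init.Ω (j + 1)))).toFinset → FluctV N) → ℝ≥0∞, Measurable ŵ ∧
            (∫⁻ a, ŵ a ∂(Measure.pi fun _ : ↥(Set.toFinite (B10Eq42TorusConstraint.bondsIn j ((s.init.Λ (j + 1))ᶜ ∩ s.init.Ω (j + 1)))).toFinset => (volume : Measure (FluctV N)))) ≠ ⊤ ∧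
            ∀ ω, ENNReal.ofReal ((WtOfRecord₁₃H F N θ p s).w j (s.init.Λ (j + 1)) ((s.init.Λ (j + 1))ᶜ ∩ s.init.Ω (j + 1)) (S (j + 1)) ω) ≤
              ŵ (fun b : ↥(Set.toFinite (B10Eq42TorusConstraint.bondsIn j ((s.init.Λ (j + 1))ᶜ ∩ s.init.Ω (j + 1)))).toFinset => (ω j).2 b)) →
        (∀ S ∈ admSOfRecord F θ.ν θ.τ9.M (gOfRecord₁₃ F N θ.toStage13Params p) p.K k s.init,
          Measurable (fun ω : MultiCfg (F.P p.K) (SU N) (FluctV N) =>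
            sect2Operand F N (FluctV N) p.K (settingOfRecord₁₃ F N θ.toStage13Params p) (θ.rzAt p s.init) s.init (t s.init) (Ek s.init)
                (UbgOfRecord₁₃CoP F N θ.toStage13Params p k s.init) (S, fun j => (ω j).2) (fun j => (ω j).1)) ∧
          ∃ CΦ : ℝ, ∀ a U, sect2Operand F N (FluctV N) p.K (settingOfRecord₁₃ F N θ.toStage13Params p) (θ.rzAt p s.init) s.init (t s.init) (Ek s.init)
                (UbgOfRecord₁₃CoP F N θ.toStage13Params p k s.init) a U ≤ CΦ) →
        (slotsTOfRecord F N θ.ν θ.τ9 (EOfRecord₁₃ F N θ.toStage13Params) (wOfRecord₉ F N θ.toStage9Params) θ.ppSel p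
            (gOfRecord₁₃ F N θ.toStage13Params p) (k + 1) s = 0 ∨
          ∀ᵐ V' ∂fieldMeasure (F.P p.K) (k + 1) (SU N),
            chiSeqOfRecord F N θ.ν θ.τ9.M (gOfRecord₁₃ F N θ.toStage13Params p) p.K (k + 1) s V' ≠ 0 →
              slotsTOfRecord F N θ.ν θ.τ9 (EOfRecord₁₃ F N θ.toStage13Params) (wOfRecord₉ F N θ.toStage9Params) θ.ppSel p
                  (gOfRecord₁₃ F N θ.toStage13Params p) (k + 1) s V' =
                sect2Slot F N (FluctV N) p.K (settingOfRecord₁₃ F N θ.toStage13Params p) (θ.rzAt p s) (WtOfRecord₁₃H F N θ p s) s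
                  (t s.init) (Ek s.init) (UbgOfRecord₁₃CoP F N θ.toStage13Params p (k + 1) s) V') := by
  obtain ⟨t, Ek, hform, hloc⟩ := (sLaw₁₃CoPH_iff_exists_local θ p k).1 hS
  refine ⟨t, Ek, hform, hloc, fun s hΩ hpre hZ hq hqloc hζm hqm hW hΦ => ?_⟩
  refine clause_succ_CoPH_of_Omega_empty_of_pinChi_of_oldBranch_of_clause_of_graph θ p h hk hM s hΩ hqloc hpre (t s.init) (Ek s.init)
    (fun S a a' Uf ha => action23_sect2ActionDataOfRecord_congr_fluct_of_isFluctLocal p.K _ _ s.init (hloc s.init) (Ek s.init) S a a' ha Uf)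
    (hform.2 s.init).2 hZ hq fun S hSm => ?_
  choose ŵ hŵm hŵfin hdom using hW S hSm
  obtain ⟨hΦm, CΦ, hΦle⟩ := hΦ S hSm
  exact integrable_oldBranch_of_dominated θ p h.zhLaws hU s S hζm hqm ŵ hŵm
    (fun j => (∫⁻ a, ŵ j a ∂(Measure.pi fun _ : ↥(Set.toFinite (B10Eq42TorusConstraint.bondsIn j ((s.init.Λ (j + 1))ᶜ ∩ s.init.Ω (j + 1)))).toFinset => (volume : Measure (FluctV N)))).toNNReal)
    (fun j => le_of_eq (ENNReal.coe_toNNReal (hŵfin j)).symm) hdom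
    (Φ := sect2Operand F N (FluctV N) p.K (settingOfRecord₁₃ F N θ.toStage13Params p) (θ.rzAt p s.init) s.init (t s.init) (Ek s.init)
                (UbgOfRecord₁₃CoP F N θ.toStage13Params p k s.init)) hΦm (fun a U => (sect2Operand_pos p.K _ _ s.init (t s.init) (Ek s.init) _ a U).le) CΦ hΦle

end Summit.QuantumFields.YangMills.Theorems.BalabanUVNodesN11NoExpansionStepSpecification

end
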